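import Mathlib.Combinatorics.SimpleGraph.Coloring.Vertex
import Mathlib.Data.ZMod.Basic
import Summits.Ventures.DiscreteObjects.UnitDistance.FiniteFieldColourings
import HarnessLib

/-!
# Kernel lower bounds for the small killer fields: `χ(unitCircleGraph (ZMod 3)) = 3` and `χ(unitCircleGraph (ZMod 7)) = 4`

Framing (verbatim for the cell): lottery ticket; floor = certified bounds/negative ranges.

`FiniteFieldColourings.lean` gives the UPPER bounds `χ ≤ 3, 4, 5, 5` for `q = 3, 7, 11, 19` by explicit kernel-checked colourings and says
'lower bounds are NOT formalised'.  This file supplies the two lower bounds that are within reach of the kernel: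
* `q = 3`: the triangle `(0,0), (1,0), (2,0)` (an `F₃`-line; cf. `adj_triangle_of_char_three`) ⇒ `¬ 2`-colourable ⇒ `χ = 3` (Madore §4);
* `q = 7`: `unitCircleGraph (ZMod 7)` is triangle-free (so no odd wheel / spindle certificate exists); a 17-vertex vertex-critical
  4-chromatic induced subgraph (found by seat udg g6 by random criticality reduction, `code/udg6/critical7b.py`) is NOT 3-colourable —
  decided by the kernel as a nested `∀ cᵢ : Fin 3, (cⱼ ≠ cᵢ →)… False` formula (a depth-first search with pruning, not a `3^17`
  enumeration) — ⇒ `χ(unitCircleGraph (ZMod 7)) = 4` exactly, the value printed in Vinh (arXiv:math/0510092, Example 1), now kernel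
  on both sides.
(`q = 11, 19`: `χ = 5`; the lower bounds there are DRAT certificates of the cell — a 5-critical core small enough for the kernel is not known.)
-/

namespace Summit.Ventures.DiscreteObjects.UnitDistance

open SimpleGraph

/-! ## `F₃`: `χ = 3` -/

/-- Three colours are forced by the triangle `(0,0) ~ (1,0) ~ (2,0) ~ (0,0)` of `unitCircleGraph (ZMod 3)`. -/
theorem not_colorable_two_zmod3 : ¬ (unitCircleGraph (ZMod 3)).Colorable 2 := by
  rintro ⟨C⟩
  have key : ∀ a b c : Fin 2, a ≠ b → a ≠ c → b ≠ c → False := by decide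
  exact key (C ((0 : ZMod 3), (0 : ZMod 3))) (C ((1 : ZMod 3), (0 : ZMod 3))) (C ((2 : ZMod 3), (0 : ZMod 3)))
    (C.valid (by decide)) (C.valid (by decide)) (C.valid (by decide))

/-- `χ(unitCircleGraph (ZMod 3)) = 3` (kernel, both bounds). -/
theorem chromaticNumber_unitCircleGraph_zmod3 : (unitCircleGraph (ZMod 3)).chromaticNumber = 3 := by
  apply le_antisymm unitCircleGraph_zmod3_colorable_three.chromaticNumber_le
  by_contra hlt
  have hlt' : (unitCircleGraph (ZMod 3)).chromaticNumber < (2 : ℕ∞) + 1 := lt_of_not_ge hlt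
  have hle : (unitCircleGraph (ZMod 3)).chromaticNumber ≤ (2 : ℕ) := Order.le_of_lt_add_one hlt'
  exact not_colorable_two_zmod3 (chromaticNumber_le_iff_colorable.mp hle)

/-! ## `F₇`: `χ = 4` via a 17-vertex 4-chromatic core -/

set_option synthInstance.maxHeartbeats 400000 in
set_option synthInstance.maxSize 16384 in
/-- The 17 core vertices, in the search order used below (each vertex after the first has a neighbour earlier in the list):
`((0 : ZMod 7), (2 : ZMod 7)), ((1 : ZMod 7), (2 : ZMod 7)), ((2 : ZMod 7), (0 : ZMod 7)), ((3 : ZMod 7), (0 : ZMod 7)), ((2 : ZMod 7), (2 : ZMod 7)), ((4 : ZMod 7), (0 : ZMod 7)), ((2 : ZMod 7), (1 : ZMod 7)), ((1 : ZMod 7), (1 : ZMod 7)), ((0 : ZMod 7), (1 : ZMod 7)), ((0 : ZMod 7), (0 : ZMod 7)), ((1 : ZMod 7), (0 : ZMod 7)), ((2 : ZMod 7), (3 : ZMod 7)), ((6 : ZMod 7), (0 : ZMod 7)), ((5 : ZMod 7), (0 : ZMod 7)), ((4 : ZMod 7), (2 : ZMod 7)), ((2 : ZMod 7), (4 : ZMod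 7)), ((4 : ZMod 7), (1 : ZMod 7))`. KERNEL FACT: the induced subgraph has no proper 3-colouring (nested `decide`: colours `cᵢ : Fin 3`, one
hypothesis `cⱼ ≠ cᵢ` per edge `j < i` of the core, 33 edges). -/
theorem ud7Core_no_three_colouring :
    ∀ c0 : Fin 3, ∀ c1 : Fin 3, c0 ≠ c1 → ∀ c2 : Fin 3, c0 ≠ c2 → ∀ c3 : Fin 3, c1 ≠ c3 → c2 ≠ c3 → ∀ c4 : Fin 3, c1 ≠ c4 → ∀ c5 : Fin 3, c3 ≠ c5 → c4 ≠ c5 → ∀ c6 : Fin 3, c2 ≠ c6 → c4 ≠ c6 → ∀ c7 : Fin 3, c1 ≠ c7 → c6 ≠ c7 → ∀ c8 : Fin 3, c0 ≠ c8 → c7 ≠ c8 → ∀ c9 : Fin 3, c4 ≠ c9 → c8 ≠ c9 → ∀ c10 : Fin 3, c2 ≠ c10 → c7 ≠ c10 → c9 ≠ c10 → ∀ c11 : Fin 3, c4 ≠ c11 → c8 ≠ c11 → ∀ c12 : Fin 3, c1 ≠ c12 → c9 ≠ c12 → ∀ c13 : Fin 3, c0 ≠ c13 → c5 ≠ c13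 → c12 ≠ c13 → ∀ c14 : Fin 3, c2 ≠ c14 → c12 ≠ c14 → ∀ c15 : Fin 3, c0 ≠ c15 → c11 ≠ c15 → c14 ≠ c15 → ∀ c16 : Fin 3, c5 ≠ c16 → c11 ≠ c16 → c14 ≠ c16 → False := by
  decide

/-- `unitCircleGraph (ZMod 7)` is not 3-colourable (restrict a 3-colouring to the core). -/
theorem not_colorable_three_zmod7 : ¬ (unitCircleGraph (ZMod 7)).Colorable 3 := by
  rintro ⟨C⟩
  exact ud7Core_no_three_colouring (C ((0 : ZMod 7), (2 : ZMod 7)))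
      (C ((1 : ZMod 7), (2 : ZMod 7)))
      (C.valid (by decide : (unitCircleGraph (ZMod 7)).Adj ((0 : ZMod 7), (2 : ZMod 7)) ((1 : ZMod 7), (2 : ZMod 7))))
      (C ((2 : ZMod 7), (0 : ZMod 7)))
      (C.valid (by decide : (unitCircleGraph (ZMod 7)).Adj ((0 : ZMod 7), (2 : ZMod 7)) ((2 : ZMod 7), (0 : ZMod 7))))
      (C ((3 : ZMod 7), (0 : ZMod 7)))
      (C.valid (by decide : (unitCircleGraph (ZMod 7)).Adj ((1 : ZMod 7), (2 : ZMod 7)) ((3 : ZMod 7), (0 : ZMod 7))))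
      (C.valid (by decide : (unitCircleGraph (ZMod 7)).Adj ((2 : ZMod 7), (0 : ZMod 7)) ((3 : ZMod 7), (0 : ZMod 7))))
      (C ((2 : ZMod 7), (2 : ZMod 7)))
      (C.valid (by decide : (unitCircleGraph (ZMod 7)).Adj ((1 : ZMod 7), (2 : ZMod 7)) ((2 : ZMod 7), (2 : ZMod 7))))
      (C ((4 : ZMod 7), (0 : ZMod 7)))
      (C.valid (by decide : (unitCircleGraph (ZMod 7)).Adj ((3 : ZMod 7), (0 : ZMod 7)) ((4 : ZMod 7), (0 : ZMod 7))))
      (C.valid (by decide : (unitCircleGraph (ZMod 7)).Adj ((2 : ZMod 7), (2 : ZMod 7)) ((4 : ZMod 7), (0 : ZMod 7))))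
      (C ((2 : ZMod 7), (1 : ZMod 7)))
      (C.valid (by decide : (unitCircleGraph (ZMod 7)).Adj ((2 : ZMod 7), (0 : ZMod 7)) ((2 : ZMod 7), (1 : ZMod 7))))
      (C.valid (by decide : (unitCircleGraph (ZMod 7)).Adj ((2 : ZMod 7), (2 : ZMod 7)) ((2 : ZMod 7), (1 : ZMod 7))))
      (C ((1 : ZMod 7), (1 : ZMod 7)))
      (C.valid (by decide : (unitCircleGraph (ZMod 7)).Adj ((1 : ZMod 7), (2 : ZMod 7)) ((1 : ZMod 7), (1 : ZMod 7))))
      (C.valid (by decide : (unitCircleGraph (ZMod 7)).Adj ((2 : ZMod 7), (1 : ZMod 7)) ((1 : ZMod 7), (1 : ZMod 7))))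
      (C ((0 : ZMod 7), (1 : ZMod 7)))
      (C.valid (by decide : (unitCircleGraph (ZMod 7)).Adj ((0 : ZMod 7), (2 : ZMod 7)) ((0 : ZMod 7), (1 : ZMod 7))))
      (C.valid (by decide : (unitCircleGraph (ZMod 7)).Adj ((1 : ZMod 7), (1 : ZMod 7)) ((0 : ZMod 7), (1 : ZMod 7))))
      (C ((0 : ZMod 7), (0 : ZMod 7)))
      (C.valid (by decide : (unitCircleGraph (ZMod 7)).Adj ((2 : ZMod 7), (2 : ZMod 7)) ((0 : ZMod 7), (0 : ZMod 7))))
      (C.valid (by decide : (unitCircleGraph (ZMod 7)).Adj ((0 : ZMod 7), (1 : ZMod 7)) ((0 : ZMod 7), (0 : ZMod 7))))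
      (C ((1 : ZMod 7), (0 : ZMod 7)))
      (C.valid (by decide : (unitCircleGraph (ZMod 7)).Adj ((2 : ZMod 7), (0 : ZMod 7)) ((1 : ZMod 7), (0 : ZMod 7))))
      (C.valid (by decide : (unitCircleGraph (ZMod 7)).Adj ((1 : ZMod 7), (1 : ZMod 7)) ((1 : ZMod 7), (0 : ZMod 7))))
      (C.valid (by decide : (unitCircleGraph (ZMod 7)).Adj ((0 : ZMod 7), (0 : ZMod 7)) ((1 : ZMod 7), (0 : ZMod 7))))
      (C ((2 : ZMod 7), (3 : ZMod 7)))
      (C.valid (by decide : (unitCircleGraph (ZMod 7)).Adj ((2 : ZMod 7), (2 : ZMod 7)) ((2 : ZMod 7), (3 : ZMod 7))))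
      (C.valid (by decide : (unitCircleGraph (ZMod 7)).Adj ((0 : ZMod 7), (1 : ZMod 7)) ((2 : ZMod 7), (3 : ZMod 7))))
      (C ((6 : ZMod 7), (0 : ZMod 7)))
      (C.valid (by decide : (unitCircleGraph (ZMod 7)).Adj ((1 : ZMod 7), (2 : ZMod 7)) ((6 : ZMod 7), (0 : ZMod 7))))
      (C.valid (by decide : (unitCircleGraph (ZMod 7)).Adj ((0 : ZMod 7), (0 : ZMod 7)) ((6 : ZMod 7), (0 : ZMod 7))))
      (C ((5 : ZMod 7), (0 : ZMod 7)))
      (C.valid (by decide : (unitCircleGraph (ZMod 7)).Adj ((0 : ZMod 7), (2 : ZMod 7)) ((5 : ZMod 7), (0 : ZMod 7))))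
      (C.valid (by decide : (unitCircleGraph (ZMod 7)).Adj ((4 : ZMod 7), (0 : ZMod 7)) ((5 : ZMod 7), (0 : ZMod 7))))
      (C.valid (by decide : (unitCircleGraph (ZMod 7)).Adj ((6 : ZMod 7), (0 : ZMod 7)) ((5 : ZMod 7), (0 : ZMod 7))))
      (C ((4 : ZMod 7), (2 : ZMod 7)))
      (C.valid (by decide : (unitCircleGraph (ZMod 7)).Adj ((2 : ZMod 7), (0 : ZMod 7)) ((4 : ZMod 7), (2 : ZMod 7))))
      (C.valid (by decide : (unitCircleGraph (ZMod 7)).Adj ((6 : ZMod 7), (0 : ZMod 7)) ((4 : ZMod 7), (2 : ZMod 7))))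
      (C ((2 : ZMod 7), (4 : ZMod 7)))
      (C.valid (by decide : (unitCircleGraph (ZMod 7)).Adj ((0 : ZMod 7), (2 : ZMod 7)) ((2 : ZMod 7), (4 : ZMod 7))))
      (C.valid (by decide : (unitCircleGraph (ZMod 7)).Adj ((2 : ZMod 7), (3 : ZMod 7)) ((2 : ZMod 7), (4 : ZMod 7))))
      (C.valid (by decide : (unitCircleGraph (ZMod 7)).Adj ((4 : ZMod 7), (2 : ZMod 7)) ((2 : ZMod 7), (4 : ZMod 7))))
      (C ((4 : ZMod 7), (1 : ZMod 7)))
      (C.valid (by decide : (unitCircleGraph (ZMod 7)).Adj ((4 : ZMod 7), (0 : ZMod 7)) ((4 : ZMod 7), (1 : ZMod 7))))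
      (C.valid (by decide : (unitCircleGraph (ZMod 7)).Adj ((2 : ZMod 7), (3 : ZMod 7)) ((4 : ZMod 7), (1 : ZMod 7))))
      (C.valid (by decide : (unitCircleGraph (ZMod 7)).Adj ((4 : ZMod 7), (2 : ZMod 7)) ((4 : ZMod 7), (1 : ZMod 7))))

/-- `χ(unitCircleGraph (ZMod 7)) = 4` (kernel, both bounds; Vinh 2005 prints this value). -/
theorem chromaticNumber_unitCircleGraph_zmod7 : (unitCircleGraph (ZMod 7)).chromaticNumber = 4 := by
  apply le_antisymm unitCircleGraph_zmod7_colorable_four.chromaticNumber_le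
  by_contra hlt
  have hlt' : (unitCircleGraph (ZMod 7)).chromaticNumber < (3 : ℕ∞) + 1 := lt_of_not_ge hlt
  have hle : (unitCircleGraph (ZMod 7)).chromaticNumber ≤ (3 : ℕ) := Order.le_of_lt_add_one hlt'
  exact not_colorable_three_zmod7 (chromaticNumber_le_iff_colorable.mp hle)

end Summit.Ventures.DiscreteObjects.UnitDistance
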